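import Literature.NumberTheory.NumberFields.ChevalleyUnitCongruence
import Literature.NumberTheory.NumberFields.ChevalleyUnitCongruenceFrobenius
import Literature.NumberTheory.NumberFields.ChevalleyUnitCongruenceDescent
import Mathlib.NumberTheory.NumberField.Units.DirichletTheorem
import Mathlib.FieldTheory.SplittingField.Construction
import Mathlib.FieldTheory.Normal.Basic
import Mathlib.FieldTheory.Perfect
import Mathlib.Data.Nat.Factorization.Induction
import HarnessLib

/-!
# Chevalley 1951, Théorème 1 for the unit group — proof (proofs file, 3/3)

Sibling proofs file of `ChevalleyUnitCongruence.lean`: it **discharges** the named fact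
`Literature.NumberTheory.NumberFields.Chevalley1951.thm1_units` (C. Chevalley, *Deux théorèmes
d'arithmétique*, J. Math. Soc. Japan **3** (1951) 36–44, Théorème 1, case `E =` unit group
[ChevalleyDeuxTheoremes1951]):

* `Literature.NumberTheory.NumberFields.Chevalley1951.thm1_units_holds : Chevalley1951.thm1_units`.

Theorems only: no `sorry`, no new definition, no new named fact (D-0026).

## The argument (Chevalley, §§1, 2, 5 and the closing remark pp. 39–40, for `E = 𝓞_Kˣ`)

For the unit group the preliminary §1 is void (`E₀ = {x : x^b ∈ E} = E`).  Fix `K`, `N`.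

1. **Prime-power exponents, modulo torsion** (`exists_modulus_primePow`; §5 with the Chebotarev
   argument of pp. 39–40).  Let `n = p^t`, `t = f + 2`, and let `L` be the splitting field over
   `K` of `(X^n - 1) ∏_g (X^n - g)`, `g` running over a generator of `μ(K)` and a fundamental
   system of units ("`L` obtenu par adjonction à `K` des racines `m`-ièmes des nombres de `E`",
   p. 39), `ζ ∈ L` a primitive `n`-th root of unity, `K' = K(ζ)`, `H = Gal(L/K')`.  For each
   `σ` Chebotarev (`ChevalleyUnitCongruenceFrobenius`, the tree's theorem) gives a prime `𝔮_σ`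
   of `K` of prime norm `ℓ_σ ∤ pN` and `𝔔_σ ∣ 𝔮_σ` in `L` with Frobenius `σ`; put
   `a = ∏_σ ℓ_σ`.  If `u ≡ 1 (mod a)` then every `σ ∈ H` fixes an `n`-th root `y ∈ 𝓞_L` of `u`
   (`Chevalley1951.smul_eq_self_of_isArithFrobAt`: "`x` est puissance `m`-ième dans la
   complétion `𝔮_j`-adique", p. 39), so `y ∈ L^H = K(ζ)` and the descent of §4
   (`ChevalleyUnitCongruenceDescent`, Chevalley's Remarque in weak form) gives
   `u = ξ w^{p^{t-1}}`, `ξ ∈ μ(K)`, i.e. `u ∈ μ(K) · (𝓞_Kˣ)^{p^{f+1}}`.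
2. **Arbitrary exponents, modulo torsion** (`exists_modulus_nat`; §2 "on peut se ramener au cas
   où `m` est puissance d'un nombre premier … `a` le p.p.c.m. des `a_i`"): multiply the moduli
   of coprime exponents and use Bezout in the abelian group `𝓞_Kˣ`.
3. **Killing the torsion** (`thm1_units_holds`): choose a prime `ℓ₀ ∤ N · #μ(K)` and let `c₀`
   be the order of `(𝓞_K/ℓ₀)ˣ`; apply step 2 with exponent `m c₀` to get `a₁`, and put
   `a = a₁ ℓ₀`.  If `u ≡ 1 (mod a)` then `u = ξ (w^{c₀})^m` with `w^{c₀} ≡ 1 (mod ℓ₀)`, so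
   `ξ ≡ 1 (mod ℓ₀)` and `ξ = 1` (distinct roots of unity stay distinct modulo a prime not
   dividing their order).  (This replaces Chevalley's §3 passage to `K(√-1)`, which the weak
   form of the Remarque makes unnecessary for units.)

## References

* C. Chevalley, *Deux théorèmes d'arithmétique*, J. Math. Soc. Japan 3 (1951) 36–44,
  Théorème 1 (p. 36) and its proof §§1–5 (pp. 36–40). [ChevalleyDeuxTheoremes1951]
* J. Tate, *Global class field theory*, Ch. VII of Cassels–Fröhlich (1967), §2.4 (Chebotarev).
  [TateGCFT1967]
-/

noncomputable section

open NumberField IsDedekindDomain Polynomial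

open scoped Classical IntermediateField

namespace Literature.NumberTheory.NumberFields

/-! ### Algebraic preliminaries -/

/-- Roots of the generators give roots of every element: if `u = g₀^k ∏ gᵢ^{eᵢ}` in an abelian
group and each `φ g` has an `n`-th root in the abelian group `M`, so does `φ u`. [folklore] -/
theorem Chevalley1951.exists_pow_eq_of_generators {G M : Type*} [CommGroup G] [CommGroup M]
    (φ : G →* M) (n : ℕ) {ι : Type*} [Fintype ι] {g₀ : G} {g : ι → G}
    (hroot₀ : ∃ Y : M, Y ^ n = φ g₀) (hroot : ∀ i, ∃ Y : M, Y ^ n = φ (g i)) {u : G}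
    (hu : ∃ (k : ℤ) (e : ι → ℤ), u = g₀ ^ k * ∏ i, g i ^ e i) : ∃ Y : M, Y ^ n = φ u := by
  obtain ⟨Y₀, hY₀⟩ := hroot₀
  choose Y hY using hroot
  obtain ⟨k, e, rfl⟩ := hu
  refine ⟨Y₀ ^ k * ∏ i, Y i ^ e i, ?_⟩
  have h0 : (Y₀ ^ k) ^ n = φ g₀ ^ k := by
    rw [← zpow_natCast, ← zpow_mul, mul_comm, zpow_mul, zpow_natCast, hY₀]
  have hi : ∀ i, (Y i ^ e i) ^ n = φ (g i) ^ e i := fun i => by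
    rw [← zpow_natCast, ← zpow_mul, mul_comm, zpow_mul, zpow_natCast, hY]
  rw [mul_pow, ← Finset.prod_pow, map_mul, map_zpow, map_prod, h0]
  congr 1
  exact Finset.prod_congr rfl fun i _ => by rw [hi, map_zpow]

/-- **Bezout in an abelian group** (Chevalley §2: "puisque `m` est le p.p.c.m. des `p_i^{e_i}`,
il en résulte que `x` est puissance `m`-ième"): if `u ∈ T·G^A` and `u ∈ T·G^B` with `(A, B) = 1`
then `u ∈ T·G^{AB}`. [cite: ChevalleyDeuxTheoremes1951, §2 (p. 37)] -/
theorem Chevalley1951.exists_torsion_mul_pow_of_coprime {G : Type*} [CommGroup G]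
    (T : Subgroup G) {A B : ℕ} (hAB : A.Coprime B) {u : G}
    (hA : ∃ (w ξ : G), ξ ∈ T ∧ u = ξ * w ^ A) (hB : ∃ (w ξ : G), ξ ∈ T ∧ u = ξ * w ^ B) :
    ∃ (w ξ : G), ξ ∈ T ∧ u = ξ * w ^ (A * B) := by
  obtain ⟨w₁, ξ₁, hξ₁, hu₁⟩ := hA
  obtain ⟨w₂, ξ₂, hξ₂, hu₂⟩ := hB
  obtain ⟨α, β, hαβ⟩ : IsCoprime (A : ℤ) (B : ℤ) := Nat.isCoprime_iff_coprime.mpr hAB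
  refine ⟨w₂ ^ α * w₁ ^ β, ξ₂ ^ (α * A) * ξ₁ ^ (β * B),
    T.mul_mem (T.zpow_mem hξ₂ _) (T.zpow_mem hξ₁ _), ?_⟩
  have e1 : (ξ₂ * w₂ ^ B) ^ (α * A : ℤ) = ξ₂ ^ (α * A : ℤ) * (w₂ ^ α) ^ (A * B) := by
    rw [mul_zpow, ← zpow_natCast w₂ B, ← zpow_mul, ← zpow_natCast (w₂ ^ α) (A * B),
      ← zpow_mul]
    congr 2
    push_cast
    ring
  have e2 : (ξ₁ * w₁ ^ A) ^ (β * B : ℤ) = ξ₁ ^ (β * B : ℤ) * (w₁ ^ β) ^ (A * B) := by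
    rw [mul_zpow, ← zpow_natCast w₁ A, ← zpow_mul, ← zpow_natCast (w₁ ^ β) (A * B),
      ← zpow_mul]
    congr 2
    push_cast
    ring
  calc u = u ^ ((α * A + β * B : ℤ)) := by rw [hαβ, zpow_one]
    _ = u ^ (α * A : ℤ) * u ^ (β * B : ℤ) := zpow_add u _ _
    _ = (ξ₂ * w₂ ^ B) ^ (α * A : ℤ) * (ξ₁ * w₁ ^ A) ^ (β * B : ℤ) := by rw [← hu₂, ← hu₁]
    _ = ξ₂ ^ (α * A : ℤ) * ξ₁ ^ (β * B : ℤ) * (w₂ ^ α * w₁ ^ β) ^ (A * B) := by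
      rw [e1, e2, mul_pow]
      exact mul_mul_mul_comm _ _ _ _

/-- A root of `X^n - c` in an extension where a multiple `P` of `X^n - c` splits. [folklore] -/
theorem Chevalley1951.exists_pow_eq_of_dvd_of_splits {K L : Type*} [Field K] [Field L]
    [Algebra K L] {P : K[X]} (hP : P ≠ 0) (hsplit : (P.map (algebraMap K L)).Splits) {n : ℕ}
    (hn : 0 < n) {c : K} (hc : (X ^ n - C c) ∣ P) : ∃ y : L, y ^ n = algebraMap K L c := by
  have hdvd : (X ^ n - C (algebraMap K L c)) ∣ P.map (algebraMap K L) := by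
    have h := Polynomial.map_dvd (algebraMap K L) hc
    rwa [Polynomial.map_sub, Polynomial.map_pow, Polynomial.map_X, Polynomial.map_C] at h
  have hsplit' : (X ^ n - C (algebraMap K L c) : L[X]).Splits :=
    hsplit.of_dvd (Polynomial.map_ne_zero hP) hdvd
  have hdeg : (X ^ n - C (algebraMap K L c) : L[X]).degree ≠ 0 := by
    rw [Polynomial.degree_X_pow_sub_C hn]
    exact_mod_cast hn.ne'
  obtain ⟨y, hy⟩ := hsplit'.exists_eval_eq_zero hdeg
  refine ⟨y, ?_⟩
  rw [Polynomial.eval_sub, Polynomial.eval_pow, Polynomial.eval_X, Polynomial.eval_C,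
    sub_eq_zero] at hy
  exact hy

/-- Distinct roots of unity of `K` stay distinct modulo a prime `ℓ₀` not dividing `#μ(K)`:
a `ξ ∈ μ(K)` with `ξ ≡ 1 (mod ℓ₀)` equals `1`. [folklore] -/
theorem Chevalley1951.torsion_eq_one_of_dvd_sub_one {K : Type*} [Field K] [NumberField K]
    {ℓ₀ : ℕ} (hℓ₀ : ℓ₀.Prime) (hℓ₀w : ¬ ℓ₀ ∣ Units.torsionOrder K) {ξ : (𝓞 K)ˣ}
    (hξ : ξ ∈ Units.torsion K) (hdvd : (ℓ₀ : 𝓞 K) ∣ (ξ : 𝓞 K) - 1) : ξ = 1 := by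
  -- a prime `Q` of `𝓞 K` above `ℓ₀`
  have hmax : (Ideal.span {(ℓ₀ : ℤ)}).IsMaximal :=
    ((Ideal.span_singleton_prime (by exact_mod_cast hℓ₀.ne_zero)).mpr
      (Nat.prime_iff_prime_int.mp hℓ₀)).isMaximal (by simpa using hℓ₀.ne_zero)
  haveI := hmax
  obtain ⟨Q, hQmax, hQover⟩ :=
    Ideal.exists_maximal_ideal_liesOver_of_isIntegral (S := 𝓞 K) (Ideal.span {(ℓ₀ : ℤ)})
  haveI := hQmax.isPrime
  -- `#μ(K) ∉ Q`
  set w := Units.torsionOrder K with hwdef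
  have hwQ : (w : 𝓞 K) ∉ Q := by
    intro h
    have h1 : (w : ℤ) ∈ Q.under ℤ := by
      rw [Ideal.under, Ideal.mem_comap, map_natCast]
      exact h
    rw [← hQover.over, Ideal.mem_span_singleton] at h1
    exact hℓ₀w (by exact_mod_cast h1)
  -- `ξ - 1 ∈ Q`
  have hℓQ : (ℓ₀ : 𝓞 K) ∈ Q := by
    have h1 : ((ℓ₀ : ℤ) : 𝓞 K) ∈ Q := by
      have h2 : (ℓ₀ : ℤ) ∈ Q.under ℤ := by
        rw [← hQover.over]
        exact Ideal.mem_span_singleton_self _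
      rw [Ideal.under, Ideal.mem_comap] at h2
      simpa using h2
    simpa using h1
  have hξQ : (ξ : 𝓞 K) - 1 ∈ Q := Ideal.mem_of_dvd _ hdvd hℓQ
  -- `ξ ^ w = 1`
  have hξw : ((ξ : 𝓞 K)) ^ w = 1 := by
    have h1 : ξ ∈ rootsOfUnity w (𝓞 K) := by
      rw [hwdef, Units.rootsOfUnity_eq_torsion]
      exact hξ
    rw [mem_rootsOfUnity] at h1
    have h2 := congrArg (fun z : (𝓞 K)ˣ => (z : 𝓞 K)) h1
    simpa using h2
  have h := Chevalley1951.eq_one_of_pow_eq_one_of_sub_one_mem Q hwQ hξw hξQ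
  exact Units.ext h

/-! ### Step 1: prime-power exponents, modulo torsion (Chevalley §5 and pp. 39–40) -/

section PrimePow

variable (K : Type) [Field K] [NumberField K]

/-- **Chevalley's Théorème 1 for units, prime-power exponent, modulo roots of unity** (§5,
p. 39, with the Chebotarev argument of pp. 39–40 and the descent of §4): for a number field `K`,
a prime `p`, `f ≥ 0` and `N > 0` there is `a > 0` prime to `N` such that every unit `u` of
`𝓞 K` with `a ∣ u - 1` lies in `μ(K) · (𝓞 Kˣ)^{p^f}`.  Proof: `t = f + 2`, `n = p^t`, `L` the
splitting field of `(X^n - 1) ∏_g (X^n - g)` over the generators `g` of `𝓞 Kˣ`, `ζ ∈ L` a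
primitive `n`-th root of unity; for each `σ ∈ Gal(L/K)` a prime `𝔮_σ` of `K` of prime norm
`ℓ_σ ∤ pN` with a prime `𝔔_σ ∣ 𝔮_σ` of `L` at which `σ` is a Frobenius (Chebotarev);
`a = ∏_σ ℓ_σ`; if `u ≡ 1 (mod a)` every `σ ∈ Gal(L/K(ζ))` fixes an `n`-th root `y` of `u`,
so `y ∈ K(ζ)` and the weak Remarque gives `u = ξ w^{p^{t-1}}`.
[cite: ChevalleyDeuxTheoremes1951, Thm 1, §5 (p. 39) and pp. 39–40] -/
theorem Chevalley1951.exists_modulus_primePow {p : ℕ} (hp : p.Prime) (f : ℕ) {N : ℕ}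
    (hN : 0 < N) :
    ∃ a : ℕ, 0 < a ∧ Nat.Coprime a N ∧
      ∀ u : (𝓞 K)ˣ, (a : 𝓞 K) ∣ (u : 𝓞 K) - 1 →
        ∃ (w ξ : (𝓞 K)ˣ), ξ ∈ Units.torsion K ∧ u = ξ * w ^ p ^ f := by
  -- the exponent `n = p^t`, `t = f + 2`
  set t : ℕ := f + 2 with htdef
  set n : ℕ := p ^ t with hndef
  have hp0 : p ≠ 0 := hp.ne_zero
  have hn : 0 < n := pow_pos hp.pos t
  haveI : NeZero n := ⟨hn.ne'⟩
  -- generators of the unit group: a generator `g₀` of `μ(K)` and a fundamental system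
  obtain ⟨g₀, hg₀⟩ := IsCyclic.exists_generator (α := Units.torsion K)
  set cK : (𝓞 K)ˣ → K := fun g => algebraMap (𝓞 K) K (g : 𝓞 K) with hcKdef
  have hcK0 : ∀ g : (𝓞 K)ˣ, cK g ≠ 0 := fun g =>
    RingOfIntegers.coe_ne_zero_iff.mpr (Units.ne_zero g)
  -- the polynomial and its splitting field
  set P : K[X] := (X ^ n - 1) * ((X ^ n - C (cK g₀)) *
    ∏ i, (X ^ n - C (cK (Units.fundSystem K i)))) with hPdef
  have hXn1 : (X ^ n - 1 : K[X]) ≠ 0 := by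
    rw [← C_1]; exact X_pow_sub_C_ne_zero hn 1
  have hXnC : ∀ c : K, (X ^ n - C c : K[X]) ≠ 0 := fun c => X_pow_sub_C_ne_zero hn c
  have hP0 : P ≠ 0 := by
    rw [hPdef]
    refine mul_ne_zero hXn1 (mul_ne_zero (hXnC _) ?_)
    exact Finset.prod_ne_zero_iff.mpr fun i _ => hXnC _
  let L := P.SplittingField
  haveI : NumberField L := NumberField.of_module_finite K L
  haveI : PerfectField K := PerfectField.ofCharZero
  haveI : IsGalois K L := isGalois_iff.mpr ⟨inferInstance, inferInstance⟩
  haveI : Fintype (L ≃ₐ[K] L) := Fintype.ofFinite _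
  have hsplit : (P.map (algebraMap K L)).Splits := SplittingField.splits P
  -- a primitive `n`-th root of unity `ζ ∈ L`
  obtain ⟨ζ, hζ⟩ : ∃ ζ : L, IsPrimitiveRoot ζ n := by
    have hdvd : Polynomial.cyclotomic n K ∣ P := by
      rw [hPdef]
      exact (Polynomial.cyclotomic.dvd_X_pow_sub_one n K).trans (dvd_mul_right _ _)
    have hdvd' : Polynomial.cyclotomic n L ∣ P.map (algebraMap K L) := by
      rw [← Polynomial.map_cyclotomic n (algebraMap K L)]
      exact Polynomial.map_dvd _ hdvd
    have hspl : (Polynomial.cyclotomic n L).Splits :=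
      hsplit.of_dvd (Polynomial.map_ne_zero hP0) hdvd'
    have hdeg : (Polynomial.cyclotomic n L).degree ≠ 0 := by
      rw [Polynomial.degree_cyclotomic]
      exact_mod_cast (Nat.totient_pos.mpr hn).ne'
    obtain ⟨ζ, hζ⟩ := hspl.exists_eval_eq_zero hdeg
    exact ⟨ζ, (Polynomial.isRoot_cyclotomic_iff_charZero hn).mp hζ⟩
  -- `n`-th roots of the generators, and of every unit, in `Lˣ`
  set φ : (𝓞 K)ˣ →* Lˣ := Units.map (algebraMap (𝓞 K) L : 𝓞 K →* L) with hφdef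
  have hφval : ∀ g : (𝓞 K)ˣ, ((φ g : Lˣ) : L) = algebraMap K L (cK g) := fun g => by
    rw [hφdef, Units.coe_map, MonoidHom.coe_coe, hcKdef]
    exact (IsScalarTower.algebraMap_apply (𝓞 K) K L _)
  have hrootφ : ∀ g : (𝓞 K)ˣ, (X ^ n - C (cK g)) ∣ P → ∃ Y : Lˣ, Y ^ n = φ g := by
    intro g hg
    obtain ⟨y, hy⟩ := Chevalley1951.exists_pow_eq_of_dvd_of_splits hP0 hsplit hn hg
    have hy0 : y ≠ 0 := by
      rintro rfl
      rw [zero_pow hn.ne'] at hy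
      exact (map_ne_zero (algebraMap K L)).mpr (hcK0 g) hy.symm
    refine ⟨Units.mk0 y hy0, Units.ext ?_⟩
    rw [Units.val_pow_eq_pow_val, Units.val_mk0, hy, hφval]
  have hroot₀ : ∃ Y : Lˣ, Y ^ n = φ (g₀ : (𝓞 K)ˣ) :=
    hrootφ _ (by rw [hPdef]; exact (dvd_mul_right _ _).trans (dvd_mul_left _ _))
  have hrooti : ∀ i, ∃ Y : Lˣ, Y ^ n = φ (Units.fundSystem K i) := fun i =>
    hrootφ _ (by
      rw [hPdef]
      exact ((Finset.dvd_prod_of_mem (fun j => (X ^ n - C (cK (Units.fundSystem K j)) : K[X]))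
        (Finset.mem_univ i)).trans (dvd_mul_left _ _)).trans (dvd_mul_left _ _))
  have hrootu : ∀ u : (𝓞 K)ˣ, ∃ Y : Lˣ, Y ^ n = φ u := by
    intro u
    refine Chevalley1951.exists_pow_eq_of_generators φ n hroot₀ hrooti ?_
    obtain ⟨⟨ξ, e⟩, hu, -⟩ := Units.exist_unique_eq_mul_prod K u
    dsimp only at hu
    obtain ⟨k, hk⟩ := Subgroup.mem_zpowers_iff.mp (hg₀ ξ)
    refine ⟨k, e, ?_⟩
    rw [hu, ← hk, SubgroupClass.coe_zpow]
  -- the field `K' = K(ζ)` and the group `H = Gal(L/K')`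
  set K' : IntermediateField K L := K⟮ζ⟯ with hK'def
  set H : Subgroup (L ≃ₐ[K] L) := K'.fixingSubgroup with hHdef
  -- the finite set of bad places: those above `p N`
  set S : Set (HeightOneSpectrum (𝓞 K)) := {v | ((p * N : ℕ) : 𝓞 K) ∈ v.asIdeal} with hSdef
  have hpN0 : ((p * N : ℕ) : 𝓞 K) ≠ 0 := by
    exact_mod_cast (Nat.mul_ne_zero hp0 hN.ne')
  have hSfin : S.Finite := by
    refine (Ideal.finite_factors (I := Ideal.span {((p * N : ℕ) : 𝓞 K)})
      (by rw [Ne, Ideal.zero_eq_bot, Ideal.span_singleton_eq_bot]; exact hpN0)).subset ?_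
    intro v hv
    exact (Ideal.dvd_span_singleton).mpr hv
  -- Chebotarev: for each `σ` a good place `v σ` of prime norm and a prime `Q σ` above it
  have hcheb := fun σ : L ≃ₐ[K] L =>
    Chevalley1951.exists_prime_absNorm_isArithFrobAt_not_mem σ hSfin
  choose v hvS hvprime Q hQ hfrob using hcheb
  set ℓ : (L ≃ₐ[K] L) → ℕ := fun σ => Ideal.absNorm (v σ).asIdeal with hℓdef
  -- the modulus
  set a : ℕ := ∏ σ, ℓ σ with hadef
  have hℓN : ∀ σ, ¬ ℓ σ ∣ N := by
    intro σ hdiv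
    apply hvS σ
    change ((p * N : ℕ) : 𝓞 K) ∈ (v σ).asIdeal
    have h1 : ((ℓ σ : ℕ) : 𝓞 K) ∈ (v σ).asIdeal := Ideal.absNorm_mem _
    rw [Nat.cast_mul]
    exact Ideal.mul_mem_left _ _ (Ideal.mem_of_dvd _ (Nat.cast_dvd_cast hdiv) h1)
  have hpQ : ∀ σ, (n : 𝓞 L) ∉ Q σ := by
    intro σ hmem
    apply hvS σ
    change ((p * N : ℕ) : 𝓞 K) ∈ (v σ).asIdeal
    haveI := (hQ σ).1
    have h1 : (p : 𝓞 L) ∈ Q σ := by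
      rw [hndef, Nat.cast_pow] at hmem
      exact Ideal.IsPrime.mem_of_pow_mem ‹_› t hmem
    have h2 : (p : 𝓞 K) ∈ (Q σ).under (𝓞 K) := by
      rw [Ideal.under, Ideal.mem_comap, map_natCast]
      exact h1
    rw [← (hQ σ).2.over] at h2
    rw [Nat.cast_mul]
    exact Ideal.mul_mem_right _ _ h2
  refine ⟨a, ?_, ?_, ?_⟩
  · exact Finset.prod_pos fun σ _ => (hvprime σ).pos
  · exact Nat.Coprime.prod_left fun σ _ => (Nat.Prime.coprime_iff_not_dvd (hvprime σ)).mpr (hℓN σ)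
  -- the main point
  intro u hu
  -- an `n`-th root `y ∈ 𝓞 L` of `u`
  obtain ⟨Y, hY⟩ := hrootu u
  set y : L := (Y : L) with hydef
  have hyn : y ^ n = algebraMap (𝓞 K) L u := by
    rw [hydef, ← Units.val_pow_eq_pow_val, hY, hφdef, Units.coe_map, MonoidHom.coe_coe]
  have hyint : IsIntegral ℤ y := by
    refine IsIntegral.of_pow hn ?_
    rw [hyn, IsScalarTower.algebraMap_apply (𝓞 K) K L]
    exact (RingOfIntegers.isIntegral_coe (u : 𝓞 K)).algebraMap
  set yO : 𝓞 L := ⟨y, hyint⟩ with hyOdef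
  have hyOn : yO ^ n = algebraMap (𝓞 K) (𝓞 L) u := by
    apply RingOfIntegers.coe_injective
    rw [map_pow]
    change y ^ n = algebraMap (𝓞 L) L (algebraMap (𝓞 K) (𝓞 L) u)
    rw [hyn, ← IsScalarTower.algebraMap_apply]
  -- `ζ` as an algebraic integer
  have hζint : IsIntegral ℤ ζ := hζ.isIntegral hn
  set ζO : 𝓞 L := ⟨ζ, hζint⟩ with hζOdef
  have hζO : IsPrimitiveRoot ζO n :=
    IsPrimitiveRoot.of_map_of_injective (f := algebraMap (𝓞 L) L)
      (by exact hζ) RingOfIntegers.coe_injective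
  -- every `σ ∈ H` fixes `y`
  have hfix : ∀ σ ∈ H, σ y = y := by
    intro σ hσ
    have hσζ : σ ζ = ζ :=
      (IntermediateField.mem_fixingSubgroup_iff _ _).mp hσ ζ
        (IntermediateField.mem_adjoin_simple_self K ζ)
    have hσζO : σ • ζO = ζO := by
      apply RingOfIntegers.coe_injective
      exact hσζ
    haveI := (hQ σ).1
    have huQ : (u : 𝓞 K) - 1 ∈ (Q σ).under (𝓞 K) := by
      rw [← (hQ σ).2.over]
      have h1 : ((a : ℕ) : 𝓞 K) ∈ (v σ).asIdeal := by
        have h2 : ((ℓ σ : ℕ) : 𝓞 K) ∈ (v σ).asIdeal := Ideal.absNorm_mem _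
        exact Ideal.mem_of_dvd _ (Nat.cast_dvd_cast
          (Finset.dvd_prod_of_mem ℓ (Finset.mem_univ σ))) h2
      exact Ideal.mem_of_dvd _ hu h1
    have h := Chevalley1951.smul_eq_self_of_isArithFrobAt (Q σ) (hfrob σ) (hpQ σ) hζO hσζO
      u huQ hyOn
    have h' := congrArg (algebraMap (𝓞 L) L) h
    exact h'
  -- hence `y ∈ K(ζ)`
  have hyK' : y ∈ K' := by
    rw [hK'def, ← IsGalois.fixedField_fixingSubgroup K⟮ζ⟯, IntermediateField.mem_fixedField_iff]
    exact hfix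
  -- the descent
  have hyx : ∃ y ∈ K⟮ζ⟯, y ^ p ^ t = algebraMap K L (algebraMap (𝓞 K) K u) :=
    ⟨y, hyK', by rw [← IsScalarTower.algebraMap_apply, ← hndef]; exact hyn⟩
  obtain ⟨w, ξ, hξ, huw⟩ :=
    Chevalley1951.exists_unit_eq_torsion_mul_pow hp (by omega : 2 ≤ t) hζ u hyx
  refine ⟨w ^ p, ξ, hξ, ?_⟩
  have ht1 : t - 1 = f + 1 := by omega
  rw [huw, ht1, pow_succ' p f, pow_mul]

end PrimePow

/-! ### Step 2: arbitrary exponents, modulo torsion (Chevalley §2) -/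

section AnyExponent

variable (K : Type) [Field K] [NumberField K]

/-- **Chevalley's Théorème 1 for units, arbitrary exponent, modulo roots of unity** (§2:
"on peut se ramener au cas où `m` est puissance d'un nombre premier … soit `a` le p.p.c.m. des
`a_i`; `a` est donc premier à `b`"): for `X > 0` and `N > 0` there is `a > 0` prime to `N`
with `u ≡ 1 (mod a) ⟹ u ∈ μ(K) · (𝓞 Kˣ)^X`.  Induction over the prime-power factorisation of
`X` (`Nat.recOnPosPrimePosCoprime`), the moduli of coprime exponents being multiplied and the
conclusions combined by Bezout (`exists_torsion_mul_pow_of_coprime`).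
[cite: ChevalleyDeuxTheoremes1951, Thm 1, §2 (p. 37)] -/
theorem Chevalley1951.exists_modulus_nat (X : ℕ) (hX : 0 < X) {N : ℕ} (hN : 0 < N) :
    ∃ a : ℕ, 0 < a ∧ Nat.Coprime a N ∧
      ∀ u : (𝓞 K)ˣ, (a : 𝓞 K) ∣ (u : 𝓞 K) - 1 →
        ∃ (w ξ : (𝓞 K)ˣ), ξ ∈ Units.torsion K ∧ u = ξ * w ^ X := by
  induction X using Nat.recOnPosPrimePosCoprime with
  | zero => exact absurd hX (lt_irrefl 0)
  | one =>
    refine ⟨1, one_pos, Nat.coprime_one_left N, fun u _ => ⟨u, 1, one_mem _, ?_⟩⟩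
    rw [pow_one, one_mul]
  | prime_pow p k hp hk => exact Chevalley1951.exists_modulus_primePow K hp k hN
  | coprime A B hA hB hAB ihA ihB =>
    obtain ⟨a₁, ha₁, ha₁N, h₁⟩ := ihA (by omega)
    obtain ⟨a₂, ha₂, ha₂N, h₂⟩ := ihB (by omega)
    refine ⟨a₁ * a₂, Nat.mul_pos ha₁ ha₂, Nat.Coprime.mul_left ha₁N ha₂N, fun u hu => ?_⟩
    rw [Nat.cast_mul] at hu
    exact Chevalley1951.exists_torsion_mul_pow_of_coprime (Units.torsion K) hAB
      (h₁ u ((dvd_mul_right _ _).trans hu)) (h₂ u ((dvd_mul_left _ _).trans hu))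

end AnyExponent

/-! ### Step 3: the theorem -/

/-- **Chevalley 1951, Théorème 1, for the unit group — PROVED** ("tout élément `x` de `E` qui
est `≡ 1 (mod a)` est puissance `m`-ième d'un élément de `E`", `E = 𝓞_Kˣ`, `a` prime to the
given `N`): discharge of the named fact `Chevalley1951.thm1_units`.  From
`exists_modulus_nat` with exponent `m c₀`, `c₀ = #(𝓞 K/ℓ₀)ˣ` for an auxiliary prime
`ℓ₀ ∤ N · #μ(K)`, and the modulus `a = a₁ ℓ₀`: `u ≡ 1 (mod a)` gives `u = ξ (w^{c₀})^m` with
`w^{c₀} ≡ 1 (mod ℓ₀)`, hence `ξ ≡ 1 (mod ℓ₀)` and `ξ = 1`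
(`torsion_eq_one_of_dvd_sub_one`).  The inputs are Chebotarev's density theorem (the tree's
theorem `infinite_setOf_frobenius_eq_of_isCyclic chebotarev_cyclotomicExtension_holds`, via
`ChevalleyUnitCongruenceFrobenius`) and the cyclotomic descent of Chevalley's §4
(`ChevalleyUnitCongruenceDescent`).
[cite: ChevalleyDeuxTheoremes1951, Thm 1 (p. 36), proof §§1–5 (pp. 36–40)] -/
theorem Chevalley1951.thm1_units_holds : Chevalley1951.thm1_units := by
  intro K _ _ m hm N hN
  -- an auxiliary prime `ℓ₀ ∤ N · #μ(K)`
  set w₀ := Units.torsionOrder K with hw₀def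
  have hw₀ : 0 < w₀ := Units.torsionOrder_pos K
  obtain ⟨ℓ₀, hℓ₀le, hℓ₀⟩ := Nat.exists_infinite_primes (N * w₀ + 1)
  have hℓ₀N : ¬ ℓ₀ ∣ N := fun h => by
    have := Nat.le_of_dvd hN h
    nlinarith
  have hℓ₀w : ¬ ℓ₀ ∣ w₀ := fun h => by
    have := Nat.le_of_dvd hw₀ h
    nlinarith
  -- `c₀ = #(𝓞 K / ℓ₀)ˣ`
  set I : Ideal (𝓞 K) := Ideal.span {(ℓ₀ : 𝓞 K)} with hIdef
  have hI : I ≠ ⊥ := by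
    rw [hIdef, Ne, Ideal.span_singleton_eq_bot]
    exact_mod_cast hℓ₀.ne_zero
  haveI : Finite (𝓞 K ⧸ I) := Ideal.finiteQuotientOfFreeOfNeBot I hI
  set c₀ : ℕ := Nat.card (𝓞 K ⧸ I)ˣ with hc₀def
  have hc₀ : 0 < c₀ := Nat.card_pos
  have hpowc₀ : ∀ v : (𝓞 K)ˣ, (ℓ₀ : 𝓞 K) ∣ (v : 𝓞 K) ^ c₀ - 1 := by
    intro v
    rw [← Ideal.mem_span_singleton, ← hIdef, ← Ideal.Quotient.eq_zero_iff_mem, map_sub, map_one,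
      map_pow, sub_eq_zero]
    have h1 : (Units.map (Ideal.Quotient.mk I : 𝓞 K →* 𝓞 K ⧸ I) v) ^ c₀ = 1 :=
      pow_card_eq_one'
    have h2 := congrArg (fun z : (𝓞 K ⧸ I)ˣ => (z : 𝓞 K ⧸ I)) h1
    simpa using h2
  -- step 2 with exponent `m c₀`
  obtain ⟨a₁, ha₁, ha₁N, h₁⟩ :=
    Chevalley1951.exists_modulus_nat K (m * c₀) (Nat.mul_pos hm hc₀) hN
  refine ⟨a₁ * ℓ₀, Nat.mul_pos ha₁ hℓ₀.pos,
    Nat.Coprime.mul_left ha₁N ((Nat.Prime.coprime_iff_not_dvd hℓ₀).mpr hℓ₀N), fun u hu => ?_⟩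
  rw [Nat.cast_mul] at hu
  obtain ⟨w, ξ, hξ, huw⟩ := h₁ u ((dvd_mul_right _ _).trans hu)
  have hℓu : (ℓ₀ : 𝓞 K) ∣ (u : 𝓞 K) - 1 := (dvd_mul_left _ _).trans hu
  -- `ξ ≡ 1 (mod ℓ₀)`, hence `ξ = 1`
  have hv1 : (ℓ₀ : 𝓞 K) ∣ ((w ^ c₀) ^ m : (𝓞 K)ˣ) - 1 := by
    have h1 := hpowc₀ w
    rw [Units.val_pow_eq_pow_val, Units.val_pow_eq_pow_val]
    exact h1.trans (by simpa using sub_dvd_pow_sub_pow ((w : 𝓞 K) ^ c₀) 1 m)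
  have hξ1 : (ℓ₀ : 𝓞 K) ∣ (ξ : 𝓞 K) - 1 := by
    have hu' : (u : 𝓞 K) = (ξ : 𝓞 K) * (((w ^ c₀) ^ m : (𝓞 K)ˣ) : 𝓞 K) := by
      rw [huw, pow_mul', Units.val_mul]
    have key : (ξ : 𝓞 K) - 1 =
        ((u : 𝓞 K) - 1) - (ξ : 𝓞 K) * ((((w ^ c₀) ^ m : (𝓞 K)ˣ) : 𝓞 K) - 1) := by
      rw [hu']; ring
    rw [key]
    exact dvd_sub hℓu (dvd_mul_of_dvd_right hv1 _)
  have hξeq : ξ = 1 := Chevalley1951.torsion_eq_one_of_dvd_sub_one hℓ₀ hℓ₀w hξ hξ1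
  refine ⟨w ^ c₀, ?_⟩
  rw [huw, hξeq, one_mul, pow_mul']

end Literature.NumberTheory.NumberFields
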